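import Literature.NumberTheory.Automorphic.UnitaryGroupStableOrbitalIntegral
import Literature.NumberTheory.Automorphic.LocalOrbitalMeasure
import Literature.NumberTheory.Rogawski1990.LocalTransfer
import Literature.LinearAlgebra.Matrix.NonderogatoryCommutantBaseChange
import HarnessLib

/-!
# Adelic orbital measures on `U(H)(𝔸_{L⁺}) ⧸ U(H)(𝔸_{L⁺})_γ` EXIST (rank `N ≥ 3`), unconditionally at REGULAR SEMISIMPLE rational `γ`
(Rogawski, *Automorphic representations of unitary groups in three variables* (1990), §5.4 p. 71 (print): the global orbital integrals
`Φ(γ, f) = ∫_{G_γ(𝔸)\G(𝔸)} f(g⁻¹ γ g) dg`; Deitmar–Echterhoff, *Principles of Harmonic Analysis* (2014), Thm. 1.5.3)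

Topic `NumberTheory/Automorphic`; namespace `Literature.NumberTheory.Automorphic.UnitaryGroup`; THEOREMS ONLY (no def, no instance,
no named fact, no `sorry`).  The ADELIC counterpart of ★ `LocalOrbitalMeasure` (p02 O9/O10): inhabitants for the measure parameter of
★ `adelicOrbitalIntegral` ∕ `adelicClassOrbitalIntegral` ∕ `adelicStableOrbitalIntegral` (T1b-3) on an ARBITRARY non-degenerate hermitian
`H` — in particular on the quasi-split `U(Φ₃)`, where no geometric side hands the measures over (for the anisotropic inner form they come
from ★ `IsOrbitalTerms` ∕ ★ `UnitaryGroupOrbitalTermsIntegrable`).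

CURRENCY NOTE (planner F0P3a-plan (g2), roster 2026-08-31T00:59Z): ★ `adelicStableOrbitalIntegral` sums `Φ(γ′, f)` over the RATIONAL classes
`[γ′] ⊂ 𝒪_st(γ)` of `U(H)(L⁺)` — the grouping `J(𝒪_st, f) = Σ_{γ} a_γ Φ(γ, f)` of (5.4.1) ∕ §14.5 (J-side ∕ T1c currency); it is NOT the
`Φ^st(γ, f)` of §5.4 p. 71, which sums over the `G(𝔸)`-classes inside the `G(𝔸̄)`-class (`= ∏_v Φ^st_v`).  The measures built here serve
both: they live on `G(𝔸) ⧸ G(𝔸)_γ`.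

* §1 `mul_comm_of_mem_centralizer_toAdelic_of_isRegularElt` — for `γ ∈ U(H)(L⁺)` with SEPARABLE characteristic polynomial
  (★ `IsRegularElt`), the centraliser of `toAdelic γ` in `U(H)(𝔸_{L⁺})` is COMMUTATIVE: its elements are adelic matrices commuting with
  `γ ⊗ 1`, and ★ `commute_of_commute_map_of_charpoly_separable` (base change of the nonderogatory commutant to the commutative
  `L`-algebra `𝔸_L`; no embedding into a product of fields is used).
* §2 `exists_adelicOrbitalMeasure` — `N ≥ 3`, `H` hermitian with `det H ≠ 0`, ANY `g ∈ U(H)(𝔸)`, any Haar `ν` on `U(H)(𝔸)` (right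
  invariant by ★ `modularCharacter_cmDatum_eq_one_of_three_le`) and any inversion-invariant Haar `ρ` on the centraliser (hypothesis
  «`G(𝔸)_g` unimodular»): a non-zero `U(H)(𝔸)`-invariant REGULAR measure on the orbit space with the quotient integral formula (★ generic
  `exists_smulInvariantMeasure_quotient_centralizer`); `_of_forall_comm` (commutative centraliser: no hypothesis on `ρ`);
  **`exists_adelicOrbitalMeasure_of_isRegularElt`** (regular semisimple RATIONAL `γ`: unconditional);
  **`exists_adelicOrbitalMeasureFamily_of_isRegularElt`** — a rational-class-indexed ★ `AdelicOrbitalMeasureFamily` whose members at the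
  REGULAR classes are non-zero, invariant and finite on compact sets (choice; the three ★ `IsOrbitalTerms` fields) — the admissible
  inhabitant «on regular classes» for any pin quantifying adelic orbital measures there.
NOT here: unimodularity of NON-commutative centralisers (singular semisimple classes: `U(2)×U(1)`-type reductive centralisers — true,
Ranga Rao 1972 ∕ Harish-Chandra, not in the tree), convergence of the orbital integrals of `C_c` functions.

## References
* J. D. Rogawski, *Automorphic Representations of Unitary Groups in Three Variables*, Ann. of Math. Stud. 123 (1990), §5.4 p. 71,
  §14.5 p. 237 (print) [Rogawski1990].
* A. Deitmar, S. Echterhoff, *Principles of Harmonic Analysis*, 2nd ed. (2014), Thm. 1.5.3 [DeitmarEchterhoff2014].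
-/

noncomputable section

open MeasureTheory Measure Set Filter Topology NumberField CompactlySupported
open Literature.MeasureTheory.Group
open scoped ENNReal NNReal Pointwise Matrix

namespace Literature.NumberTheory.Automorphic

namespace UnitaryGroup

open Literature.NumberTheory.Rogawski1990
open Literature.AlgebraicGeometry.ShimuraVarieties (hermForm)

variable (L : Type) [Field L] [NumberField L] [IsCMField L] (N : ℕ) (H : Matrix (Fin N) (Fin N) L)

/-! ## §1 The adelic centraliser of a regular semisimple rational element is commutative -/

/-- The matrix of `toAdelic γ` is `γ ⊗ 1 = γ.map (algebraMap L 𝔸_L)`. [cite: Rogawski1990, §5.4 p. 71] -/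
theorem coe_toAdelic_val_eq_map (γ : (cmDatum L N H).Rational) :
    ((((cmDatum L N H).toAdelic γ).val : GL (Fin N) (AdeleRing (𝓞 L) L)) : Matrix (Fin N) (Fin N) (AdeleRing (𝓞 L) L)) =
      ((γ.val : GL (Fin N) L) : Matrix (Fin N) (Fin N) L).map (algebraMap L (AdeleRing (𝓞 L) L)) := by
  rw [coe_cmDatum_toAdelic, val_toAdeleGL]

/-- **The centraliser of `toAdelic γ` in `U(H)(𝔸_{L⁺})` is commutative for `γ ∈ U(H)(L⁺)` REGULAR SEMISIMPLE** (`IsRegularElt`: separable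
characteristic polynomial): its elements are adelic matrices commuting with `γ ⊗ 1`, and the commutant of a nonderogatory matrix stays
commutative under base change to the commutative `L`-algebra `𝔸_L` (★ `commute_of_commute_map_of_charpoly_separable`).
[cite: Rogawski1990, §3.1 p. 19] -/
theorem mul_comm_of_mem_centralizer_toAdelic_of_isRegularElt (γ : (cmDatum L N H).Rational)
    (hreg : IsRegularElt (γ.val : GL (Fin N) L)) :
    ∀ a ∈ Subgroup.centralizer ({(cmDatum L N H).toAdelic γ} : Set (cmDatum L N H).Adelic),
      ∀ b ∈ Subgroup.centralizer ({(cmDatum L N H).toAdelic γ} : Set (cmDatum L N H).Adelic), a * b = b * a := by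
  intro a ha b hb
  rw [Subgroup.mem_centralizer_singleton_iff] at ha hb
  -- on matrices: `a, b` commute with `γ ⊗ 1`
  have hmat : ∀ {x : (cmDatum L N H).Adelic}, x * (cmDatum L N H).toAdelic γ = (cmDatum L N H).toAdelic γ * x →
      Commute (((γ.val : GL (Fin N) L) : Matrix (Fin N) (Fin N) L).map (algebraMap L (AdeleRing (𝓞 L) L)))
        ((x.val : GL (Fin N) (AdeleRing (𝓞 L) L)) : Matrix (Fin N) (Fin N) (AdeleRing (𝓞 L) L)) := fun {x} hx => by
    have h : ((x.val : GL (Fin N) (AdeleRing (𝓞 L) L)) : Matrix (Fin N) (Fin N) (AdeleRing (𝓞 L) L)) *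
        ((((cmDatum L N H).toAdelic γ).val : GL (Fin N) (AdeleRing (𝓞 L) L)) : Matrix (Fin N) (Fin N) (AdeleRing (𝓞 L) L)) =
        ((((cmDatum L N H).toAdelic γ).val : GL (Fin N) (AdeleRing (𝓞 L) L)) : Matrix (Fin N) (Fin N) (AdeleRing (𝓞 L) L)) *
          ((x.val : GL (Fin N) (AdeleRing (𝓞 L) L)) : Matrix (Fin N) (Fin N) (AdeleRing (𝓞 L) L)) :=
      congrArg (fun z : (cmDatum L N H).Adelic =>
        ((z.val : GL (Fin N) (AdeleRing (𝓞 L) L)) : Matrix (Fin N) (Fin N) (AdeleRing (𝓞 L) L))) hx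
    rw [coe_toAdelic_val_eq_map] at h
    exact h.symm
  have hc : Commute ((a.val : GL (Fin N) (AdeleRing (𝓞 L) L)) : Matrix (Fin N) (Fin N) (AdeleRing (𝓞 L) L))
      ((b.val : GL (Fin N) (AdeleRing (𝓞 L) L)) : Matrix (Fin N) (Fin N) (AdeleRing (𝓞 L) L)) :=
    Literature.LinearAlgebra.Matrix.commute_of_commute_map_of_charpoly_separable _ hreg (hmat ha) (hmat hb)
  exact Subtype.ext (Units.ext hc.eq)

/-! ## §2 Invariant measures on the adelic orbit spaces -/

section Measures

variable [MeasurableSpace (cmDatum L N H).Adelic] [BorelSpace (cmDatum L N H).Adelic]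

/-- **The measure of the global orbital integrals exists** (rank `N ≥ 3`, `H` hermitian with `det H ≠ 0`): for `g ∈ U(H)(𝔸_{L⁺})`,
ANY Haar measure `ν` on `U(H)(𝔸_{L⁺})` (right invariant: the group is unimodular, ★ `modularCharacter_cmDatum_eq_one_of_three_le`) and
any inversion-invariant Haar measure `ρ` on the centraliser (hypothesis «`U(H)(𝔸)_g` unimodular»), there is a `U(H)(𝔸)`-invariant
REGULAR measure `m ≠ 0` on `U(H)(𝔸) ⧸ U(H)(𝔸)_g` with the quotient integral formula `∫ (∫_{G_g} f(x h) dρ) dm = ∫ f dν` — the `dg` of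
`Φ(γ, f) = ∫_{G_γ(𝔸)\G(𝔸)} f(g⁻¹γg) dg`. [cite: Rogawski1990, §5.4 p. 71] [cite: DeitmarEchterhoff2014, Thm. 1.5.3] -/
theorem exists_adelicOrbitalMeasure (hN : 3 ≤ N) (hH : (H.map (cmConjRingHom L))ᵀ = H) (hdet : H.det ≠ 0)
    (g : (cmDatum L N H).Adelic) (ν : Measure (cmDatum L N H).Adelic) [IsHaarMeasure ν]
    [MeasurableSpace (Subgroup.centralizer ({g} : Set (cmDatum L N H).Adelic))]
    [BorelSpace (Subgroup.centralizer ({g} : Set (cmDatum L N H).Adelic))]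
    (ρ : Measure (Subgroup.centralizer ({g} : Set (cmDatum L N H).Adelic))) [IsHaarMeasure ρ] [ρ.IsInvInvariant]
    [MeasurableSpace ((cmDatum L N H).Adelic ⧸ Subgroup.centralizer ({g} : Set (cmDatum L N H).Adelic))]
    [BorelSpace ((cmDatum L N H).Adelic ⧸ Subgroup.centralizer ({g} : Set (cmDatum L N H).Adelic))] :
    ∃ m : Measure ((cmDatum L N H).Adelic ⧸ Subgroup.centralizer ({g} : Set (cmDatum L N H).Adelic)),
      SMulInvariantMeasure (cmDatum L N H).Adelic _ m ∧ m.Regular ∧ m ≠ 0 ∧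
        ∀ f : CompactlySupportedContinuousMap (cmDatum L N H).Adelic ℝ,
          ∫ x, fiberIntegral (Subgroup.centralizer ({g} : Set (cmDatum L N H).Adelic)) ρ f x ∂m = ∫ y, f y ∂ν := by
  haveI : ν.IsMulRightInvariant :=
    isMulRightInvariant_of_modularCharacterFun_eq_one (fun x => modularCharacter_cmDatum_eq_one_of_three_le L hN H hH hdet x) ν
  exact exists_smulInvariantMeasure_quotient_centralizer g ν ρ

/-- The same for a COMMUTATIVE centraliser: no hypothesis on the Haar measure `ρ` of `U(H)(𝔸)_g`.
[cite: Rogawski1990, §5.4 p. 71] [cite: DeitmarEchterhoff2014, Thm. 1.5.3] -/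
theorem exists_adelicOrbitalMeasure_of_forall_comm (hN : 3 ≤ N) (hH : (H.map (cmConjRingHom L))ᵀ = H) (hdet : H.det ≠ 0)
    (g : (cmDatum L N H).Adelic)
    (hcomm : ∀ a ∈ Subgroup.centralizer ({g} : Set (cmDatum L N H).Adelic),
      ∀ b ∈ Subgroup.centralizer ({g} : Set (cmDatum L N H).Adelic), a * b = b * a)
    (ν : Measure (cmDatum L N H).Adelic) [IsHaarMeasure ν]
    [MeasurableSpace (Subgroup.centralizer ({g} : Set (cmDatum L N H).Adelic))]
    [BorelSpace (Subgroup.centralizer ({g} : Set (cmDatum L N H).Adelic))]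
    (ρ : Measure (Subgroup.centralizer ({g} : Set (cmDatum L N H).Adelic))) [IsHaarMeasure ρ]
    [MeasurableSpace ((cmDatum L N H).Adelic ⧸ Subgroup.centralizer ({g} : Set (cmDatum L N H).Adelic))]
    [BorelSpace ((cmDatum L N H).Adelic ⧸ Subgroup.centralizer ({g} : Set (cmDatum L N H).Adelic))] :
    ∃ m : Measure ((cmDatum L N H).Adelic ⧸ Subgroup.centralizer ({g} : Set (cmDatum L N H).Adelic)),
      SMulInvariantMeasure (cmDatum L N H).Adelic _ m ∧ m.Regular ∧ m ≠ 0 ∧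
        ∀ f : CompactlySupportedContinuousMap (cmDatum L N H).Adelic ℝ,
          ∫ x, fiberIntegral (Subgroup.centralizer ({g} : Set (cmDatum L N H).Adelic)) ρ f x ∂m = ∫ y, f y ∂ν := by
  haveI : ν.IsMulRightInvariant :=
    isMulRightInvariant_of_modularCharacterFun_eq_one (fun x => modularCharacter_cmDatum_eq_one_of_three_le L hN H hH hdet x) ν
  exact exists_smulInvariantMeasure_quotient_centralizer_of_forall_comm g hcomm ν ρ

/-- **Unconditionally at a REGULAR SEMISIMPLE rational `γ`**: a non-zero `U(H)(𝔸)`-invariant measure, finite on compact sets, on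
`U(H)(𝔸) ⧸ U(H)(𝔸)_γ` (`γ` diagonally embedded; §1 makes the centraliser commutative; Haar measures supplied internally).
[cite: Rogawski1990, §5.4 p. 71] [cite: DeitmarEchterhoff2014, Thm. 1.5.3] -/
theorem exists_adelicOrbitalMeasure_of_isRegularElt (hN : 3 ≤ N) (hH : (H.map (cmConjRingHom L))ᵀ = H) (hdet : H.det ≠ 0)
    (γ : (cmDatum L N H).Rational) (hreg : IsRegularElt (γ.val : GL (Fin N) L))
    [MeasurableSpace ((cmDatum L N H).Adelic ⧸
      Subgroup.centralizer ({(cmDatum L N H).toAdelic γ} : Set (cmDatum L N H).Adelic))]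
    [BorelSpace ((cmDatum L N H).Adelic ⧸
      Subgroup.centralizer ({(cmDatum L N H).toAdelic γ} : Set (cmDatum L N H).Adelic))] :
    ∃ m : Measure ((cmDatum L N H).Adelic ⧸ Subgroup.centralizer ({(cmDatum L N H).toAdelic γ} : Set (cmDatum L N H).Adelic)),
      SMulInvariantMeasure (cmDatum L N H).Adelic _ m ∧ IsFiniteMeasureOnCompacts m ∧ m ≠ 0 := by
  letI : MeasurableSpace (Subgroup.centralizer ({(cmDatum L N H).toAdelic γ} : Set (cmDatum L N H).Adelic)) := borel _
  haveI : BorelSpace (Subgroup.centralizer ({(cmDatum L N H).toAdelic γ} : Set (cmDatum L N H).Adelic)) := ⟨rfl⟩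
  haveI : LocallyCompactSpace (Subgroup.centralizer ({(cmDatum L N H).toAdelic γ} : Set (cmDatum L N H).Adelic)) :=
    (isClosed_coe_centralizer_singleton ((cmDatum L N H).toAdelic γ)).isClosedEmbedding_subtypeVal.locallyCompactSpace
  obtain ⟨m, hinv, hreg', hne, -⟩ := exists_adelicOrbitalMeasure_of_forall_comm L N H hN hH hdet ((cmDatum L N H).toAdelic γ)
    (mul_comm_of_mem_centralizer_toAdelic_of_isRegularElt L N H γ hreg) Measure.haar Measure.haar
  haveI := hreg'
  exact ⟨m, hinv, inferInstance, hne⟩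

/-- **An adelic orbital measure family that is admissible on the REGULAR classes**: for `N ≥ 3` and `H` hermitian with `det H ≠ 0` there
is a rational-class-indexed ★ `AdelicOrbitalMeasureFamily` whose member at every class `[γ]` with `γ_c = out [γ]` regular semisimple is
non-zero, `U(H)(𝔸)`-invariant and finite on compact sets (choice over `exists_adelicOrbitalMeasure_of_isRegularElt`; the zero measure
off the regular classes, where nothing is claimed). [cite: Rogawski1990, §5.4 p. 71] -/
theorem exists_adelicOrbitalMeasureFamily_of_isRegularElt (hN : 3 ≤ N) (hH : (H.map (cmConjRingHom L))ᵀ = H) (hdet : H.det ≠ 0)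
    [∀ g : (cmDatum L N H).Adelic,
      MeasurableSpace ((cmDatum L N H).Adelic ⧸ Subgroup.centralizer ({g} : Set (cmDatum L N H).Adelic))]
    [∀ g : (cmDatum L N H).Adelic,
      BorelSpace ((cmDatum L N H).Adelic ⧸ Subgroup.centralizer ({g} : Set (cmDatum L N H).Adelic))] :
    ∃ μ : AdelicOrbitalMeasureFamily L N H, ∀ c : ConjClasses (cmDatum L N H).Rational,
      IsRegularElt ((Quotient.out c : (cmDatum L N H).Rational).val : GL (Fin N) L) →
        SMulInvariantMeasure (cmDatum L N H).Adelic _ (μ c) ∧ IsFiniteMeasureOnCompacts (μ c) ∧ μ c ≠ 0 := by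
  classical
  refine ⟨fun c => if h : IsRegularElt ((Quotient.out c : (cmDatum L N H).Rational).val : GL (Fin N) L) then
      (exists_adelicOrbitalMeasure_of_isRegularElt L N H hN hH hdet (Quotient.out c) h).choose else 0, fun c hc => ?_⟩
  simp only [dif_pos hc]
  exact (exists_adelicOrbitalMeasure_of_isRegularElt L N H hN hH hdet (Quotient.out c) hc).choose_spec

end Measures

end UnitaryGroup

end Literature.NumberTheory.Automorphic
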